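import Mathlib.AlgebraicGeometry.Noetherian
import Literature.AlgebraicGeometry.Motives.VarietiesRegularProofs
import HarnessLib

/-!
# The dimension bound `dim X ≤ dim R + n` for a scheme smooth of relative dimension `n` over a noetherian ring

Topic: `Literature/AlgebraicGeometry/Dimension`. `Motives/VarietiesDimensionProofs` proves that a
non-empty scheme smooth of relative dimension `n` over a FIELD has dimension `n`
(`Motives.topologicalKrullDim_eq_of_smoothOfRelativeDimension`). This file proves the relative
upper bound over an arbitrary noetherian base ring `R`:

* (input, `Motives/VarietiesRegularProofs`) `Motives.Ideal.height_eq_height_under_of_etale_of_isPrime`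
  — étale maps preserve heights of all primes: for `S` étale over a noetherian ring `R` and a prime
  `Q` of `S`, `ht Q = ht (Q ∩ R)` (the dimension formula `ht Q = ht p + ht (Q/pS)` under going down,
  Stacks 00ON, and the vanishing of heights in the fibres of an unramified map);
* `height_le_of_isStandardSmoothOfRelativeDimension_of_isNoetherianRing`,
  `ringKrullDim_le_of_isStandardSmoothOfRelativeDimension` — a standard smooth algebra `S` of
  relative dimension `n` over a noetherian ring `R` has `ht Q ≤ dim R + n` for every prime `Q`,
  hence `dim S ≤ dim R + n` (factor `R → R[X₁,…,Xₙ] → S` with the second map étale, Mathlib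
  `Algebra.IsStandardSmoothOfRelativeDimension.exists_etale_mvPolynomial`, and
  `dim R[X₁,…,Xₙ] = dim R + n`, Mathlib `MvPolynomial.ringKrullDim_of_isNoetherianRing`);
* `ringKrullDim_stalk_le_of_smoothOfRelativeDimension_of_isNoetherianRing`,
  `topologicalKrullDim_le_of_smoothOfRelativeDimension` — for `f : X → Spec R` smooth of relative
  dimension `n` (Mathlib `SmoothOfRelativeDimension`), `R` noetherian: `dim 𝒪_{X,x} ≤ dim R + n`
  for every `x`, and `dim X ≤ dim R + n` (the charts `Γ(Spec R, U) → Γ(X, V)` of the definition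
  are standard smooth of relative dimension `n`, `dim Γ(Spec R, U) ≤ dim R` for an affine open
  `U ⊆ Spec R`, and `dim X = sup_x dim 𝒪_{X,x}`,
  `Motives.Scheme.topologicalKrullDim_eq_iSup_ringKrullDim_stalk`).

These are the standard consequences of the dimension formula for flat morphisms (Görtz–Wedhorn I,
Lemma 6.26 is the field case; the relative form is Stacks 00ON applied to the étale chart); used
in `KTheory/HuComplexDimensionVanishing` to bound the dimension of a smooth `W(k)`-scheme of
relative dimension `d` by `d + 1`.

## References

* The Stacks project, Tag 00OM/00ON (the dimension formula `ht P = ht p + ht (P/pS)` under going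
  down). [StacksProject]
* U. Görtz, T. Wedhorn, *Algebraic Geometry I: Schemes*, 2nd ed. (2020), Def. 6.14, Lemma 6.26,
  Lemma 5.7 (4). [GortzWedhorn2020]
-/

universe u

open Ideal

namespace Literature.AlgebraicGeometry.Dimension

/-! ### Heights of primes in standard smooth algebras over a noetherian ring -/

section Ring

variable {R S : Type*} [CommRing R] [CommRing S] [Algebra R S]

/-- **Primes of a standard smooth algebra of relative dimension `n` over a noetherian ring `R` have
height at most `dim R + n`.** Proof: `R → S` factors as `R → R[X₁,…,Xₙ] → S` with `R[X₁,…,Xₙ] → S`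
étale (Mathlib `Algebra.IsStandardSmoothOfRelativeDimension.exists_etale_mvPolynomial`); étale
maps preserve heights (`Motives.Ideal.height_eq_height_under_of_etale_of_isPrime`), heights in
`R[X₁,…,Xₙ]` are bounded by its dimension `dim R + n` (Mathlib
`MvPolynomial.ringKrullDim_of_isNoetherianRing`). [cite: StacksProject, Tag 00ON] -/
theorem height_le_of_isStandardSmoothOfRelativeDimension_of_isNoetherianRing [IsNoetherianRing R]
    (n : ℕ) [Algebra.IsStandardSmoothOfRelativeDimension n R S] (Q : Ideal S) [hQ : Q.IsPrime] :
    (Q.height : WithBot ℕ∞) ≤ ringKrullDim R + n := by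
  obtain ⟨g, hg⟩ := Algebra.IsStandardSmoothOfRelativeDimension.exists_etale_mvPolynomial n R S
  algebraize [g.toRingHom]
  rw [Literature.AlgebraicGeometry.Motives.Ideal.height_eq_height_under_of_etale_of_isPrime
    (R := MvPolynomial (Fin n) R) Q]
  refine (Ideal.height_le_ringKrullDim_of_ne_top (Ideal.IsPrime.ne_top inferInstance)).trans ?_
  rw [MvPolynomial.ringKrullDim_of_isNoetherianRing, Nat.card_eq_fintype_card, Fintype.card_fin]

/-- A standard smooth algebra `S` of relative dimension `n` over a noetherian ring `R` has
`dim S ≤ dim R + n`. [cite: StacksProject, Tag 00ON] -/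
theorem ringKrullDim_le_of_isStandardSmoothOfRelativeDimension [IsNoetherianRing R] (n : ℕ)
    [Algebra.IsStandardSmoothOfRelativeDimension n R S] : ringKrullDim S ≤ ringKrullDim R + n :=
  (ringKrullDim_le_iff_isMaximal_height_le _).mpr fun M _ =>
    height_le_of_isStandardSmoothOfRelativeDimension_of_isNoetherianRing n M

/-- `RingHom` form of `ringKrullDim_le_of_isStandardSmoothOfRelativeDimension`: if `φ : A →+* B`
is standard smooth of relative dimension `n` and `A` is noetherian, `dim B ≤ dim A + n`.
[cite: StacksProject, Tag 00ON] -/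
theorem RingHom.ringKrullDim_le_of_isStandardSmoothOfRelativeDimension {A B : Type*} [CommRing A]
    [CommRing B] [IsNoetherianRing A] {n : ℕ} {φ : A →+* B}
    (hφ : φ.IsStandardSmoothOfRelativeDimension n) : ringKrullDim B ≤ ringKrullDim A + n := by
  algebraize [φ]
  exact Literature.AlgebraicGeometry.Dimension.ringKrullDim_le_of_isStandardSmoothOfRelativeDimension
    (R := A) (S := B) n

end Ring

/-! ### Schemes smooth of relative dimension `n` over a noetherian affine base -/

section Scheme

open _root_.AlgebraicGeometry CategoryTheory TopologicalSpace

variable {R : CommRingCat.{u}} {X : Scheme.{u}} (f : X ⟶ Spec R) (n : ℕ)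

/-- The coordinate ring of an affine open `U ⊆ Spec R` has dimension at most `dim R`
(`U ≅ Spec Γ(Spec R, U)` is a subspace of `Spec R`; Mathlib `topologicalKrullDim_subspace_le`,
`PrimeSpectrum.topologicalKrullDim_eq_ringKrullDim`). [folklore] -/
theorem ringKrullDim_of_isAffineOpen_le {U : (Spec R).Opens} (hU : IsAffineOpen U) :
    ringKrullDim Γ(Spec R, U) ≤ ringKrullDim R := by
  rw [← PrimeSpectrum.topologicalKrullDim_eq_ringKrullDim Γ(Spec R, U),
    ← PrimeSpectrum.topologicalKrullDim_eq_ringKrullDim R]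
  change topologicalKrullDim (Spec Γ(Spec R, U)) ≤ topologicalKrullDim (Spec R)
  rw [← IsHomeomorph.topologicalKrullDim_eq _ hU.isoSpec.hom.homeomorph.isHomeomorph]
  exact topologicalKrullDim_subspace_le (Spec R) U

/-- **Local rings of a scheme smooth of relative dimension `n` over a noetherian ring `R` have
dimension at most `dim R + n`.** With a chart of the definition (Mathlib
`SmoothOfRelativeDimension`: affine opens `x ∈ V ⊆ f⁻¹ U` with `Γ(Spec R, U) → Γ(X, V)` standard
smooth of relative dimension `n`), `𝒪_{X,x}` is the localisation of `Γ(X, V)` at a prime, whose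
height is at most `dim Γ(Spec R, U) + n ≤ dim R + n`
(`height_le_of_isStandardSmoothOfRelativeDimension_of_isNoetherianRing`,
`ringKrullDim_of_isAffineOpen_le`). [cite: StacksProject, Tag 00ON] -/
theorem ringKrullDim_stalk_le_of_smoothOfRelativeDimension_of_isNoetherianRing
    [IsNoetherianRing R] [SmoothOfRelativeDimension n f] (x : X) :
    ringKrullDim (X.presheaf.stalk x) ≤ ringKrullDim R + n := by
  obtain ⟨U, hU, V, hV, hxV, e, hstd⟩ :=
    SmoothOfRelativeDimension.exists_isStandardSmoothOfRelativeDimension (n := n) (f := f) x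
  haveI : IsNoetherianRing Γ(Spec R, U) := IsLocallyNoetherian.component_noetherian ⟨U, hU⟩
  algebraize [(f.appLE U V e).hom]
  have := hV.isLocalization_stalk ⟨x, hxV⟩
  rw [@IsLocalization.AtPrime.ringKrullDim_eq_height _ _ (hV.primeIdealOf ⟨x, hxV⟩).asIdeal _
    (X.presheaf.stalk x) _ (TopCat.Presheaf.algebra_section_stalk X.presheaf ⟨x, hxV⟩) this]
  refine (height_le_of_isStandardSmoothOfRelativeDimension_of_isNoetherianRing
    (R := Γ(Spec R, U)) n _).trans ?_
  exact add_le_add (ringKrullDim_of_isAffineOpen_le hU) le_rfl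

/-- **A scheme smooth of relative dimension `n` over a noetherian ring `R` has dimension at most
`dim R + n`** (`dim X = sup_x dim 𝒪_{X,x}`, `Motives.Scheme.topologicalKrullDim_eq_iSup_ringKrullDim_stalk`,
and `ringKrullDim_stalk_le_of_smoothOfRelativeDimension_of_isNoetherianRing`). Over a field
(`dim R = 0`) equality holds for non-empty `X`
(`Motives.topologicalKrullDim_eq_of_smoothOfRelativeDimension`). [cite: StacksProject, Tag 00ON] -/
theorem topologicalKrullDim_le_of_smoothOfRelativeDimension [IsNoetherianRing R]
    [SmoothOfRelativeDimension n f] : topologicalKrullDim X ≤ ringKrullDim R + n := by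
  rw [Literature.AlgebraicGeometry.Motives.Scheme.topologicalKrullDim_eq_iSup_ringKrullDim_stalk]
  exact iSup_le fun x =>
    ringKrullDim_stalk_le_of_smoothOfRelativeDimension_of_isNoetherianRing f n x

/-- `ℕ`-valued form: if moreover `dim R ≤ e`, then `dim X ≤ e + n`. [cite: StacksProject, Tag 00ON] -/
theorem topologicalKrullDim_le_of_smoothOfRelativeDimension_of_le [IsNoetherianRing R]
    [SmoothOfRelativeDimension n f] {e : ℕ} (he : ringKrullDim R ≤ e) :
    topologicalKrullDim X ≤ (e + n : ℕ) := by
  refine (topologicalKrullDim_le_of_smoothOfRelativeDimension f n).trans ?_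
  push_cast
  exact add_le_add he le_rfl

end Scheme

end Literature.AlgebraicGeometry.Dimension
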